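import Summits.Ventures.PercRepro.RLSRuleTwoLinesSixSupply

/-!
# C-025 at q = 3: the `6`-point planes with two `3`-point lines — the loss-free supply and the demands (night-3, gen 4)

* `twoLinesSix_supply_free` — no loss (`Λ = ∅`): `18T₀ + 54T₁ + 54T₂ + W ≤ Σ_{S ∈ Yq} w⁺(G, S)` (the `5`-set weights
  `8c + 18(3 − c) + 10c = 54` do not depend on `c = |ℓ ∩ ℓ′|`);
* the demands: `≤ 39` at `t = 1`, `≤ 33` at `t = 2`, and at `t = 3` the independent triples with an independent
  complement, `≤ 18 − 2c` (`card_UqG_le_twoLinesSix_t3`, stated as `#U_G + 2c ≤ 18`).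
The types are closed in `RLSRuleTwoLinesSix`.  Imports `RLSRuleTwoLinesSixSupply`.  Axioms: standard.
-/

open scoped Matroid

namespace PercRepro

namespace NightThree

open Finset ThmH PerFlat

variable {α : Type*} [DecidableEq α] {M : Matroid α} [M.Finite]

open scoped Classical in
/-- **The profile accounting of a `6`-point plane with two lines, no loss** (`Λ = ∅`). -/
theorem twoLinesSix_supply_free {p : ℕ} (hc : Core M p) {G ℓ ℓ' K : Finset α} {n : ℕ} (hG : G ∈ flatsQ M 3)
    (h : TwoLinesAny M G ℓ ℓ') (hGc : G.card = 6) (hKsub : K ⊆ gr M \ G) (hKind : M.Indep (K : Set α))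
    (hemp : coplanarTriples M ℓ K = ∅) (hemp' : coplanarTriples M ℓ' K = ∅) :
    18 * (∑ X ∈ witnessFamily K n, 1 / (((3 + X.card).choose 3 : ℕ) : ℚ))
    + 54 * (∑ X ∈ witnessFamily K n, 1 / (((4 + X.card).choose 3 : ℕ) : ℚ))
    + 54 * (∑ X ∈ witnessFamily K n, 1 / (((5 + X.card).choose 3 : ℕ) : ℚ))
    + (∑ _X ∈ witnessFamily K n, (1 : ℚ))
    ≤ ∑ S ∈ Yq M (n + 4) 3, wPlus M G S := by
  obtain ⟨hmem3, h𝔅rank, hd34, hd5, hd6, hc3, hc4, hc5⟩ := twoLinesSix_family hc hG h hGc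
  have hdep : depTriples M G = {ℓ, ℓ'} := depTriples_eq_pair_of_twoLinesAny h
  have hmeet := card_inter_le_one_of_twoLines' hG h
  obtain ⟨hℓG, hℓ'G, hℓc, hℓ'c, hℓr, hℓ'r, hne, hsimple, hind⟩ := h
  have h' : TwoLinesAny M G ℓ ℓ' := ⟨hℓG, hℓ'G, hℓc, hℓ'c, hℓr, hℓ'r, hne, hsimple, hind⟩
  have hsup := supply_ge_profile hc hG hKsub hKind n (∅ : Finset (Finset α))
    (fun m hm _ => by
      rw [hdep, Finset.mem_insert, Finset.mem_singleton] at hm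
      rcases hm with rfl | rfl
      · exact hemp
      · exact hemp') (fun _ => ∅)
    (fun m hm => absurd hm (Finset.notMem_empty m)) h𝔅rank
  refine le_trans ?_ hsup
  have hval : ∀ B X, (if ∀ m ∈ (∅ : Finset (Finset α)), m ⊆ B → ¬ (fun _ => (∅ : Finset α)) m ⊆ X then
      profileShare M B X else 0) = profileShare M B X := by
    intro B X
    rw [if_pos (fun m hm => absurd hm (Finset.notMem_empty m))]
  simp only [hval]
  have h3 : ∑ B ∈ ((G.powersetCard 3).erase ℓ).erase ℓ', ∑ X ∈ witnessFamily K n, profileShare M B X =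
      18 * (∑ X ∈ witnessFamily K n, 1 / (((3 + X.card).choose 3 : ℕ) : ℚ)) := by
    have hv : ∀ B ∈ ((G.powersetCard 3).erase ℓ).erase ℓ', ∑ X ∈ witnessFamily K n, profileShare M B X =
        ∑ X ∈ witnessFamily K n, 1 / (((3 + X.card).choose 3 : ℕ) : ℚ) := by
      intro B hB
      obtain ⟨hBG, hBc, hl, hl', _⟩ := hmem3 B hB
      apply Finset.sum_congr rfl
      intro X _
      unfold profileShare
      rw [if_pos (by omega), rho3_of_twoLines' h' hBG, hBc]
      simp only [if_neg hl, if_neg hl', Nat.choose_self, Nat.sub_zero, Nat.cast_one]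
    rw [Finset.sum_congr rfl hv, Finset.sum_const, hc3, nsmul_eq_mul]
    norm_num
  have h4 : ∑ B ∈ G.powersetCard 4, ∑ X ∈ witnessFamily K n, profileShare M B X =
      3 * (3 * ∑ X ∈ witnessFamily K n, 1 / (((4 + X.card).choose 3 : ℕ) : ℚ))
      + 3 * (3 * ∑ X ∈ witnessFamily K n, 1 / (((4 + X.card).choose 3 : ℕ) : ℚ))
      + 9 * (4 * ∑ X ∈ witnessFamily K n, 1 / (((4 + X.card).choose 3 : ℕ) : ℚ)) := by
    have hnb : ∀ B ∈ G.powersetCard 4, ¬ (ℓ ⊆ B ∧ ℓ' ⊆ B) := by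
      rintro B hB ⟨hl, hl'⟩
      have hu := Finset.card_union_add_card_inter ℓ ℓ'
      have := Finset.card_le_card (Finset.union_subset hl hl')
      rw [(Finset.mem_powersetCard.1 hB).2] at this
      omega
    apply sum_powersetCard_four_twoSix hG h' hGc
    · intro B hB hl
      have hl' : ¬ ℓ' ⊆ B := fun hl' => hnb B hB ⟨hl, hl'⟩
      obtain ⟨hBG, hBc⟩ := Finset.mem_powersetCard.1 hB
      rw [Finset.mul_sum]; apply Finset.sum_congr rfl; intro X _
      unfold profileShare
      rw [if_pos (by omega), rho3_of_twoLines' h' hBG, hBc, show Nat.choose 4 3 = 4 by norm_num [Nat.choose]]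
      simp only [if_pos hl, if_neg hl', Nat.sub_zero]; norm_num [div_eq_mul_inv]
    · intro B hB hl'
      have hl : ¬ ℓ ⊆ B := fun hl => hnb B hB ⟨hl, hl'⟩
      obtain ⟨hBG, hBc⟩ := Finset.mem_powersetCard.1 hB
      rw [Finset.mul_sum]; apply Finset.sum_congr rfl; intro X _
      unfold profileShare
      rw [if_pos (by omega), rho3_of_twoLines' h' hBG, hBc, show Nat.choose 4 3 = 4 by norm_num [Nat.choose]]
      simp only [if_neg hl, if_pos hl', Nat.sub_zero]; norm_num [div_eq_mul_inv]
    · intro B hB hl hl'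
      obtain ⟨hBG, hBc⟩ := Finset.mem_powersetCard.1 hB
      rw [Finset.mul_sum]; apply Finset.sum_congr rfl; intro X _
      unfold profileShare
      rw [if_pos (by omega), rho3_of_twoLines' h' hBG, hBc, show Nat.choose 4 3 = 4 by norm_num [Nat.choose]]
      simp only [if_neg hl, if_neg hl', Nat.sub_zero]; norm_num [div_eq_mul_inv]
  have h5 : ∑ B ∈ G.powersetCard 5, ∑ X ∈ witnessFamily K n, profileShare M B X =
      ((ℓ ∩ ℓ').card : ℚ) * (8 * ∑ X ∈ witnessFamily K n, 1 / (((5 + X.card).choose 3 : ℕ) : ℚ))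
      + (3 - ((ℓ ∩ ℓ').card : ℚ)) * (9 * ∑ X ∈ witnessFamily K n, 1 / (((5 + X.card).choose 3 : ℕ) : ℚ))
      + (3 - ((ℓ ∩ ℓ').card : ℚ)) * (9 * ∑ X ∈ witnessFamily K n, 1 / (((5 + X.card).choose 3 : ℕ) : ℚ))
      + ((ℓ ∩ ℓ').card : ℚ) * (10 * ∑ X ∈ witnessFamily K n, 1 / (((5 + X.card).choose 3 : ℕ) : ℚ)) := by
    apply sum_powersetCard_five_twoSix hG h' hGc
    · intro B hB hl hl'
      obtain ⟨hBG, hBc⟩ := Finset.mem_powersetCard.1 hB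
      rw [Finset.mul_sum]; apply Finset.sum_congr rfl; intro X _
      unfold profileShare
      rw [if_pos (by omega), rho3_of_twoLines' h' hBG, hBc, show Nat.choose 5 3 = 10 by norm_num [Nat.choose]]
      simp only [if_pos hl, if_pos hl']; norm_num [div_eq_mul_inv]
    · intro B hB hl hl'
      obtain ⟨hBG, hBc⟩ := Finset.mem_powersetCard.1 hB
      rw [Finset.mul_sum]; apply Finset.sum_congr rfl; intro X _
      unfold profileShare
      rw [if_pos (by omega), rho3_of_twoLines' h' hBG, hBc, show Nat.choose 5 3 = 10 by norm_num [Nat.choose]]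
      simp only [if_pos hl, if_neg hl', Nat.sub_zero]; norm_num [div_eq_mul_inv]
    · intro B hB hl hl'
      obtain ⟨hBG, hBc⟩ := Finset.mem_powersetCard.1 hB
      rw [Finset.mul_sum]; apply Finset.sum_congr rfl; intro X _
      unfold profileShare
      rw [if_pos (by omega), rho3_of_twoLines' h' hBG, hBc, show Nat.choose 5 3 = 10 by norm_num [Nat.choose]]
      simp only [if_neg hl, if_pos hl', Nat.sub_zero]; norm_num [div_eq_mul_inv]
    · intro B hB hl hl'
      obtain ⟨hBG, hBc⟩ := Finset.mem_powersetCard.1 hB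
      rw [Finset.mul_sum]; apply Finset.sum_congr rfl; intro X _
      unfold profileShare
      rw [if_pos (by omega), rho3_of_twoLines' h' hBG, hBc, show Nat.choose 5 3 = 10 by norm_num [Nat.choose]]
      simp only [if_neg hl, if_neg hl', Nat.sub_zero]; norm_num [div_eq_mul_inv]
  have h6 : ∑ X ∈ witnessFamily K n, profileShare M G X = ∑ _X ∈ witnessFamily K n, (1 : ℚ) := by
    apply Finset.sum_congr rfl; intro X _; unfold profileShare; rw [if_neg (by omega)]
  rw [Finset.sum_union hd6, Finset.sum_union hd5, Finset.sum_union hd34, Finset.sum_singleton, h3, h4, h5, h6]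
  rcases Nat.le_one_iff_eq_zero_or_eq_one.1 hmeet with hc0 | hc1
  · rw [hc0]; push_cast; linarith
  · rw [hc1]; push_cast; linarith

/-! ### The demand -/

/-- At `t = 1`: `≤ 39`. -/
theorem card_UqG_le_twoLinesSix_t1 {G ℓ ℓ' : Finset α} {n : ℕ} (h : TwoLinesAny M G ℓ ℓ') (hGc : G.card = 6)
    (hK : M.eRk ((gr M \ G : Finset α) : Set α) = ((n + 3 : ℕ) : ℕ∞)) : (UqG M (n + 4) 3 G).card ≤ 39 := by
  obtain ⟨hℓG, hℓ'G, hℓc, hℓ'c, hℓr, hℓ'r, hne, hsimple, hind⟩ := h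
  have hsub : UqG M (n + 4) 3 G ⊆ ((G.powersetCard 3).erase ℓ).erase ℓ' ∪ G.powersetCard 4 ∪ G.powersetCard 5 := by
    intro B hB
    have hle := card_add_le_of_mem_UqG hB hK (by omega : n + 3 + 1 ≤ n + 4)
    have hB' := hB
    unfold UqG at hB'
    rw [Finset.mem_filter, mem_Uq] at hB'
    obtain ⟨⟨_, hB3, _⟩, hBG⟩ := hB'
    have hB3' : M.eRk (B : Set α) = 3 := by exact_mod_cast hB3
    have hBc := three_le_card_of_eRk_eq_three hB3'
    simp only [Finset.mem_union, Finset.mem_erase, Finset.mem_powersetCard]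
    rcases (show B.card = 3 ∨ B.card = 4 ∨ B.card = 5 by omega) with h3 | h4 | h5
    · left; left
      refine ⟨?_, ?_, hBG, h3⟩
      · rintro rfl; rw [hℓ'r] at hB3'; exact absurd hB3' (by decide)
      · rintro rfl; rw [hℓr] at hB3'; exact absurd hB3' (by decide)
    · left; right; exact ⟨hBG, h4⟩
    · right; exact ⟨hBG, h5⟩
  have hc3 : (((G.powersetCard 3).erase ℓ).erase ℓ').card = 18 := by
    rw [Finset.card_erase_of_mem, Finset.card_erase_of_mem (Finset.mem_powersetCard.2 ⟨hℓG, hℓc⟩),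
      Finset.card_powersetCard, hGc]
    · rfl
    · rw [Finset.mem_erase, Finset.mem_powersetCard]; exact ⟨hne.symm, hℓ'G, hℓ'c⟩
  calc (UqG M (n + 4) 3 G).card
      ≤ (((G.powersetCard 3).erase ℓ).erase ℓ' ∪ G.powersetCard 4 ∪ G.powersetCard 5).card := Finset.card_le_card hsub
    _ ≤ (((G.powersetCard 3).erase ℓ).erase ℓ' ∪ G.powersetCard 4).card + (G.powersetCard 5).card :=
        Finset.card_union_le _ _
    _ ≤ (((G.powersetCard 3).erase ℓ).erase ℓ').card + (G.powersetCard 4).card + (G.powersetCard 5).card := by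
        have := Finset.card_union_le (((G.powersetCard 3).erase ℓ).erase ℓ') (G.powersetCard 4); omega
    _ = 39 := by rw [hc3, Finset.card_powersetCard, Finset.card_powersetCard, hGc]; rfl

/-- At `t = 2`: `≤ 33`. -/
theorem card_UqG_le_twoLinesSix_t2 {G ℓ ℓ' : Finset α} {n : ℕ} (h : TwoLinesAny M G ℓ ℓ') (hGc : G.card = 6)
    (hK : M.eRk ((gr M \ G : Finset α) : Set α) = ((n + 2 : ℕ) : ℕ∞)) : (UqG M (n + 4) 3 G).card ≤ 33 := by
  obtain ⟨hℓG, hℓ'G, hℓc, hℓ'c, hℓr, hℓ'r, hne, hsimple, hind⟩ := h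
  have hsub : UqG M (n + 4) 3 G ⊆ ((G.powersetCard 3).erase ℓ).erase ℓ' ∪ G.powersetCard 4 := by
    intro B hB
    have hle := card_add_le_of_mem_UqG hB hK (by omega : n + 2 + 2 ≤ n + 4)
    have hB' := hB
    unfold UqG at hB'
    rw [Finset.mem_filter, mem_Uq] at hB'
    obtain ⟨⟨_, hB3, _⟩, hBG⟩ := hB'
    have hB3' : M.eRk (B : Set α) = 3 := by exact_mod_cast hB3
    have hBc := three_le_card_of_eRk_eq_three hB3'
    simp only [Finset.mem_union, Finset.mem_erase, Finset.mem_powersetCard]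
    rcases (show B.card = 3 ∨ B.card = 4 by omega) with h3 | h4
    · left
      refine ⟨?_, ?_, hBG, h3⟩
      · rintro rfl; rw [hℓ'r] at hB3'; exact absurd hB3' (by decide)
      · rintro rfl; rw [hℓr] at hB3'; exact absurd hB3' (by decide)
    · right; exact ⟨hBG, h4⟩
  have hc3 : (((G.powersetCard 3).erase ℓ).erase ℓ').card = 18 := by
    rw [Finset.card_erase_of_mem, Finset.card_erase_of_mem (Finset.mem_powersetCard.2 ⟨hℓG, hℓc⟩),
      Finset.card_powersetCard, hGc]
    · rfl
    · rw [Finset.mem_erase, Finset.mem_powersetCard]; exact ⟨hne.symm, hℓ'G, hℓ'c⟩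
  calc (UqG M (n + 4) 3 G).card ≤ (((G.powersetCard 3).erase ℓ).erase ℓ' ∪ G.powersetCard 4).card :=
        Finset.card_le_card hsub
    _ ≤ (((G.powersetCard 3).erase ℓ).erase ℓ').card + (G.powersetCard 4).card := Finset.card_union_le _ _
    _ = 33 := by rw [hc3, Finset.card_powersetCard, hGc]; rfl

/-- At `t = 3`: the demanded triples are independent with an independent complement: `≤ 18 − 2c`. -/
theorem card_UqG_le_twoLinesSix_t3 {G ℓ ℓ' : Finset α} {n : ℕ} (hG : G ∈ flatsQ M 3) (h : TwoLinesAny M G ℓ ℓ')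
    (hGc : G.card = 6) (hK : M.eRk ((gr M \ G : Finset α) : Set α) = ((n + 1 : ℕ) : ℕ∞)) :
    (UqG M (n + 4) 3 G).card + 2 * (ℓ ∩ ℓ').card ≤ 18 := by
  have hmeet := card_inter_le_one_of_twoLines' hG h
  obtain ⟨hℓG, hℓ'G, hℓc, hℓ'c, hℓr, hℓ'r, hne, hsimple, hind⟩ := h
  have hc3 : (((G.powersetCard 3).erase ℓ).erase ℓ').card = 18 := by
    rw [Finset.card_erase_of_mem, Finset.card_erase_of_mem (Finset.mem_powersetCard.2 ⟨hℓG, hℓc⟩),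
      Finset.card_powersetCard, hGc]
    · rfl
    · rw [Finset.mem_erase, Finset.mem_powersetCard]; exact ⟨hne.symm, hℓ'G, hℓ'c⟩
  -- the bottom sets are independent triples `B` with `G ∖ B ≠ ℓ, ℓ′`
  have hsub : UqG M (n + 4) 3 G ⊆ ((((G.powersetCard 3).erase ℓ).erase ℓ').erase (G \ ℓ)).erase (G \ ℓ') := by
    intro B hB
    have hle := card_add_le_of_mem_UqG hB hK (by omega : n + 1 + 3 ≤ n + 4)
    have hge := eRk_sdiff_ge_of_mem_UqG hB hK (by omega : n + 1 + 3 ≤ n + 4)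
    have hB' := hB
    unfold UqG at hB'
    rw [Finset.mem_filter, mem_Uq] at hB'
    obtain ⟨⟨_, hB3, _⟩, hBG⟩ := hB'
    have hB3' : M.eRk (B : Set α) = 3 := by exact_mod_cast hB3
    have hBc := three_le_card_of_eRk_eq_three hB3'
    simp only [Finset.mem_erase, Finset.mem_powersetCard]
    refine ⟨?_, ?_, ?_, ?_, hBG, by omega⟩
    · intro hBeq
      have : G \ B = ℓ' := by rw [hBeq, Finset.sdiff_sdiff_eq_self hℓ'G]
      rw [this, hℓ'r] at hge
      exact absurd hge (by decide)
    · intro hBeq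
      have : G \ B = ℓ := by rw [hBeq, Finset.sdiff_sdiff_eq_self hℓG]
      rw [this, hℓr] at hge
      exact absurd hge (by decide)
    · rintro rfl; rw [hℓ'r] at hB3'; exact absurd hB3' (by decide)
    · rintro rfl; rw [hℓr] at hB3'; exact absurd hB3' (by decide)
  have hle := Finset.card_le_card hsub
  rcases Nat.le_one_iff_eq_zero_or_eq_one.1 hmeet with hc0 | hc1
  · -- disjoint lines: nothing more to erase (`G ∖ ℓ = ℓ′`)
    have h1 := Finset.card_erase_le (s := (((G.powersetCard 3).erase ℓ).erase ℓ').erase (G \ ℓ)) (a := G \ ℓ')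
    have h2 := Finset.card_erase_le (s := ((G.powersetCard 3).erase ℓ).erase ℓ') (a := G \ ℓ)
    omega
  · -- a common point: `G ∖ ℓ` and `G ∖ ℓ′` are two distinct independent triples of the family
    have hdisj : (G \ ℓ) ≠ ℓ' := by
      intro heq
      have h0 : ℓ ∩ ℓ' = ∅ := by rw [← heq]; exact Finset.inter_sdiff_self ℓ G
      rw [h0, Finset.card_empty] at hc1
      exact absurd hc1 (by norm_num)
    have hdisj' : (G \ ℓ') ≠ ℓ := by
      intro heq
      have h0 : ℓ ∩ ℓ' = ∅ := by rw [← heq]; exact Finset.sdiff_inter_self ℓ' G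
      rw [h0, Finset.card_empty] at hc1
      exact absurd hc1 (by norm_num)
    have hmem1 : G \ ℓ ∈ ((G.powersetCard 3).erase ℓ).erase ℓ' := by
      rw [Finset.mem_erase, Finset.mem_erase, Finset.mem_powersetCard]
      refine ⟨hdisj, ?_, Finset.sdiff_subset, by rw [Finset.card_sdiff_of_subset hℓG, hGc, hℓc]⟩
      intro heq
      have h0 : ℓ ∩ ℓ = ∅ := by
        have := Finset.inter_sdiff_self ℓ G
        rwa [heq] at this
      rw [Finset.inter_self] at h0
      rw [h0, Finset.card_empty] at hℓc
      exact absurd hℓc (by norm_num)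
    have hne12 : G \ ℓ ≠ G \ ℓ' := by
      intro heq
      have := congrArg (fun S => G \ S) heq
      simp only [Finset.sdiff_sdiff_eq_self hℓG, Finset.sdiff_sdiff_eq_self hℓ'G] at this
      exact hne this
    have hmem2 : G \ ℓ' ∈ (((G.powersetCard 3).erase ℓ).erase ℓ').erase (G \ ℓ) := by
      rw [Finset.mem_erase, Finset.mem_erase, Finset.mem_erase, Finset.mem_powersetCard]
      refine ⟨hne12.symm, ?_, hdisj', Finset.sdiff_subset, by rw [Finset.card_sdiff_of_subset hℓ'G, hGc, hℓ'c]⟩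
      intro heq
      have h0 : ℓ' ∩ ℓ' = ∅ := by
        have := Finset.inter_sdiff_self ℓ' G
        rwa [heq] at this
      rw [Finset.inter_self] at h0
      rw [h0, Finset.card_empty] at hℓ'c
      exact absurd hℓ'c (by norm_num)
    rw [Finset.card_erase_of_mem hmem2, Finset.card_erase_of_mem hmem1, hc3] at hle
    omega


end NightThree

end PercRepro
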